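import Mathlib
import HarnessLib
import Summits.HubbardSuperconductivity.HubbardSuperconductivity.Theorems.KLProgrammeC4aAbsBubbleNonCooper

/-!
# Route `KLProgramme` — crux C4a, S3 brick (B4) «(U1)-LAWS» part 9: the FOLD-BOX THRESHOLDS ARE JOINTLY FEASIBLE (non-vacuity) — positive `n`-free `Wφ, t` such that
# every box with `dist₀ ≤ t`, `hi ≤ t`, half-width `Wφ` meets the window hypothesis, the slope budget, the rate window and the caustic budget of parts 4a/4b/5d

Cell `gate-hubbard-kl`, seat hubbard-kl-k3c3-p3 (g31; row «implicit-function / monotonicity route for μ(n)»).  Located brick for the (C)-closer lane / the (M4)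
assembly of the umklapp first-order ϑ-layer (stub (C) `stub_twoLeg_curvature` of `KLRegimeEngineV17F2`, stmt-HubbardSuperconductivity-20437), memo
HOME/hubbard-kl-k3c3-p3/U1-CAUSTIC-SUP.md §11.  Twin, for the fold box, of `…C4aCausticWindowCoverFree.exists_coverThresholds(_frame)` for the cover theorem.
* **`exists_foldBox_thresholds`**: under the Sizes rows and `w > 0` there are `Wφ > 0` and `t > 0` (functions of the frame sizes only) with
  `K₁(t + 2msD₁Wφ) < r`, `t + 2msD₁Wφ ≤ 3/10`, `t + 2msD₁Wφ ≤ u_min`, and for all `0 ≤ dist₀ ≤ t`, `0 < hi ≤ t`: the modulus inequality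
  `L(dist₀, hi, Wφ) ≤ w·u_min²` (hence `hwin` by `…C4aFoldBoxModulus.foldBox_hwin_of_le`), the slope budget `K₂msD₁(dist₀ + 2hi/(Dt−2A)) ≤ w·u_min²·Wφ` (margin
  `W_m = Wφ`: the window `[x₀ − Wφ, x₀ + Wφ]`), the rate window `K₂(dist₀ + 2(hi/(Dt−2A) + msD₁Wφ))/(Dt−2A) ≤ 1/2`, and the caustic budget `dist₀ + 2msD₁Wφ ≤ Δ := t + 2msD₁Wφ`
  — the hypotheses of `…C4aFoldBoxPartnerBandLaws` / `…PostLaws` / `…C4aFoldBoxPreLaw` hold simultaneously on every near-caustic box of an umklapp sheet that is small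
  enough, with `n`-free sizes.  Order of choice: `Wφ` (five shares), then `t` (six shares).
Sizes binder shape; pure bookkeeping; nothing asserts (C), K3 or superconductivity.  References: FST II CPAM 51 (1998) §3 [cite: FeldmanSalmhoferTrubowitz1998].
-/

noncomputable section

namespace Summit.HubbardSuperconductivity.HubbardSuperconductivity.Theorems.C4a

set_option linter.dupNamespace false -- summit = problem name (single-conjunct summit), D-0017

open Real Set
open Literature.MathematicalPhysics.QuantumLattice Literature.MathematicalPhysics.QuantumLattice.BandSectorCounting
open Literature.MathematicalPhysics.QuantumLattice.FermiRG
open Summit.HubbardSuperconductivity.HubbardSuperconductivity.Theorems.KLRegimeSplit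
open Summit.HubbardSuperconductivity.HubbardSuperconductivity.Theorems.DispersionFlow
open Summit.HubbardSuperconductivity.HubbardSuperconductivity.Theorems.PerturbedFermiCurve

set_option maxHeartbeats 400000 in
/-- Abstract feasibility: nonnegative coefficients, positive `c₂, dd, u, r` ⟹ positive `Wφ, t` meeting the four budgets (see `exists_foldBox_thresholds`). -/
theorem exists_foldBox_thresholds_abstract {K₁ K₂ K₃ D₁ D₂ D₃ RR U' dd c₂ u r : ℝ} (hK₁ : 0 ≤ K₁) (hK₂ : 0 ≤ K₂) (hK₃ : 0 ≤ K₃) (hD₁ : 0 ≤ D₁) (hD₂ : 0 ≤ D₂)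
    (hD₃ : 0 ≤ D₃) (hRR : 0 ≤ RR) (hU' : 0 ≤ U') (hdd : 0 < dd) (hc₂ : 0 < c₂) (hu : 0 < u) (hr : 0 < r) :
    ∃ Wφ t : ℝ, 0 < Wφ ∧ 0 < t ∧ K₁ * (t + 2 * (D₁ * Wφ)) < r ∧ t + 2 * (D₁ * Wφ) ≤ 3 / 10 ∧ t + 2 * (D₁ * Wφ) ≤ u ∧
      ∀ dist₀ hi : ℝ, 0 ≤ dist₀ → dist₀ ≤ t → 0 < hi → hi ≤ t →
        K₃ * (dist₀ + hi / dd + D₁ * Wφ) * D₁ ^ 2 + K₂ * (RR * hi + D₂ * Wφ) * (D₁ + D₁) + K₂ * (dist₀ + hi / dd + D₁ * Wφ) * D₂ + K₁ * (U' * hi + D₃ * Wφ) ≤ c₂ ∧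
        K₂ * D₁ * (dist₀ + 2 * (hi / dd)) ≤ c₂ * Wφ ∧
        K₂ * (dist₀ + 2 * (hi / dd + D₁ * Wφ)) / dd ≤ 1 / 2 := by
  -- the `Wφ`-coefficient of the modulus
  set T₁ : ℝ := K₃ * D₁ ^ 3 + 2 * K₂ * D₂ * D₁ + K₂ * D₁ * D₂ + K₁ * D₃ with hT₁
  have hT₁0 : 0 ≤ T₁ := by positivity
  set Wφ : ℝ := min (c₂ / (2 * (T₁ + 1))) (min (dd / (4 * (2 * K₂ * D₁ + 1))) (min (3 / (20 * (2 * D₁ + 1))) (min (u / (2 * (2 * D₁ + 1)))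
    (r / (4 * (2 * K₁ * D₁ + 1)))))) with hWφ
  have hWφpos : 0 < Wφ := by
    simp only [hWφ, lt_min_iff]; refine ⟨by positivity, by positivity, by positivity, by positivity, by positivity⟩
  have hW1 : Wφ ≤ c₂ / (2 * (T₁ + 1)) := min_le_left _ _
  have hW2 : Wφ ≤ dd / (4 * (2 * K₂ * D₁ + 1)) := (min_le_right _ _).trans (min_le_left _ _)
  have hW3 : Wφ ≤ 3 / (20 * (2 * D₁ + 1)) := (min_le_right _ _).trans ((min_le_right _ _).trans (min_le_left _ _))
  have hW4 : Wφ ≤ u / (2 * (2 * D₁ + 1)) := (min_le_right _ _).trans ((min_le_right _ _).trans ((min_le_right _ _).trans (min_le_left _ _)))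
  have hW5 : Wφ ≤ r / (4 * (2 * K₁ * D₁ + 1)) := (min_le_right _ _).trans ((min_le_right _ _).trans ((min_le_right _ _).trans (min_le_right _ _)))
  clear_value Wφ
  -- consequences for the `Wφ`-shares (`a·W ≤ (a+1)·W ≤ target`)
  have hWφ0 : 0 ≤ Wφ := hWφpos.le
  have hS1 : T₁ * Wφ ≤ c₂ / 2 := by
    have h := (le_div_iff₀ (by positivity)).1 hW1
    have : T₁ * Wφ ≤ (T₁ + 1) * Wφ := mul_le_mul_of_nonneg_right (by linarith) hWφ0
    linarith
  have hS2 : 2 * K₂ * D₁ * Wφ ≤ dd / 4 := by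
    have h := (le_div_iff₀ (by positivity)).1 hW2
    have : 2 * K₂ * D₁ * Wφ ≤ (2 * K₂ * D₁ + 1) * Wφ := mul_le_mul_of_nonneg_right (by linarith) hWφ0
    linarith
  have hS3 : 2 * (D₁ * Wφ) ≤ 3 / 20 := by
    have h := (le_div_iff₀ (by positivity)).1 hW3
    have : 2 * D₁ * Wφ ≤ (2 * D₁ + 1) * Wφ := mul_le_mul_of_nonneg_right (by linarith) hWφ0
    linarith
  have hS4 : 2 * (D₁ * Wφ) ≤ u / 2 := by
    have h := (le_div_iff₀ (by positivity)).1 hW4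
    have : 2 * D₁ * Wφ ≤ (2 * D₁ + 1) * Wφ := mul_le_mul_of_nonneg_right (by linarith) hWφ0
    linarith
  have hS5 : K₁ * (2 * (D₁ * Wφ)) ≤ r / 4 := by
    have h := (le_div_iff₀ (by positivity)).1 hW5
    have : 2 * K₁ * D₁ * Wφ ≤ (2 * K₁ * D₁ + 1) * Wφ := mul_le_mul_of_nonneg_right (by linarith) hWφ0
    linarith
  clear hW1 hW2 hW3 hW4 hW5
  -- the `t`-coefficient (sum over all constraints) and `t`
  set Q : ℝ := (K₃ * D₁ ^ 2 + K₂ * D₂) * (1 + 1 / dd) + 2 * K₂ * RR * D₁ + K₁ * U' + K₂ * D₁ * (1 + 2 / dd) + K₂ * (1 + 2 / dd) / dd + K₁ + 1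
    with hQ
  have hQpos : 0 < Q := by positivity
  set t : ℝ := min (c₂ / (2 * Q)) (min (c₂ * Wφ / Q) (min (1 / (4 * Q)) (min (3 / 20) (min (u / 2) (r / (4 * (K₁ + 1))))))) with ht
  have htpos : 0 < t := by
    simp only [ht, lt_min_iff]; refine ⟨by positivity, by positivity, by positivity, by norm_num, by positivity, by positivity⟩
  have ht1 : t ≤ c₂ / (2 * Q) := min_le_left _ _
  have ht2 : t ≤ c₂ * Wφ / Q := (min_le_right _ _).trans (min_le_left _ _)
  have ht3 : t ≤ 1 / (4 * Q) := (min_le_right _ _).trans ((min_le_right _ _).trans (min_le_left _ _))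
  have ht4 : t ≤ 3 / 20 := (min_le_right _ _).trans ((min_le_right _ _).trans ((min_le_right _ _).trans (min_le_left _ _)))
  have ht5 : t ≤ u / 2 := (min_le_right _ _).trans ((min_le_right _ _).trans ((min_le_right _ _).trans ((min_le_right _ _).trans (min_le_left _ _))))
  have ht6 : t ≤ r / (4 * (K₁ + 1)) := (min_le_right _ _).trans ((min_le_right _ _).trans ((min_le_right _ _).trans ((min_le_right _ _).trans (min_le_right _ _))))
  clear_value t
  have hQt1 : Q * t ≤ c₂ / 2 := by
    have h := (le_div_iff₀ (by positivity)).1 ht1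
    linarith
  have hQt2 : Q * t ≤ c₂ * Wφ := by
    have h := (le_div_iff₀ hQpos).1 ht2
    linarith
  have hQt3 : Q * t ≤ 1 / 4 := by
    have h := (le_div_iff₀ (by positivity)).1 ht3
    linarith
  have hK₁t : K₁ * t ≤ r / 4 := by
    have h := (le_div_iff₀ (by positivity)).1 ht6
    have : K₁ * t ≤ (K₁ + 1) * t := mul_le_mul_of_nonneg_right (by linarith) htpos.le
    linarith
  clear ht1 ht2 ht3 ht6
  have hbud : K₁ * (t + 2 * (D₁ * Wφ)) < r := by rw [mul_add]; linarith
  refine ⟨Wφ, t, hWφpos, htpos, hbud, by linarith, by linarith, fun dist₀ hi hd0 hdt hhi0 hhit => ⟨?_, ?_, ?_⟩⟩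
  · -- the modulus
    have hsplit : K₃ * (dist₀ + hi / dd + D₁ * Wφ) * D₁ ^ 2 + K₂ * (RR * hi + D₂ * Wφ) * (D₁ + D₁) + K₂ * (dist₀ + hi / dd + D₁ * Wφ) * D₂ +
        K₁ * (U' * hi + D₃ * Wφ) =
        (K₃ * D₁ ^ 2 + K₂ * D₂) * dist₀ + ((K₃ * D₁ ^ 2 + K₂ * D₂) / dd + 2 * K₂ * RR * D₁ + K₁ * U') * hi + T₁ * Wφ := by
      rw [hT₁]; field_simp; ring
    rw [hsplit]
    have h1 : (K₃ * D₁ ^ 2 + K₂ * D₂) * dist₀ ≤ (K₃ * D₁ ^ 2 + K₂ * D₂) * t := mul_le_mul_of_nonneg_left hdt (by positivity)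
    have h2 : ((K₃ * D₁ ^ 2 + K₂ * D₂) / dd + 2 * K₂ * RR * D₁ + K₁ * U') * hi ≤ ((K₃ * D₁ ^ 2 + K₂ * D₂) / dd + 2 * K₂ * RR * D₁ + K₁ * U') * t :=
      mul_le_mul_of_nonneg_left hhit (by positivity)
    have h3 : (K₃ * D₁ ^ 2 + K₂ * D₂) * t + ((K₃ * D₁ ^ 2 + K₂ * D₂) / dd + 2 * K₂ * RR * D₁ + K₁ * U') * t ≤ Q * t := by
      rw [← add_mul]
      refine mul_le_mul_of_nonneg_right ?_ htpos.le
      rw [hQ]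
      have : 0 ≤ K₂ * D₁ * (1 + 2 / dd) + K₂ * (1 + 2 / dd) / dd + K₁ + 1 := by positivity
      have e1 : (K₃ * D₁ ^ 2 + K₂ * D₂) + ((K₃ * D₁ ^ 2 + K₂ * D₂) / dd + 2 * K₂ * RR * D₁ + K₁ * U') =
          (K₃ * D₁ ^ 2 + K₂ * D₂) * (1 + 1 / dd) + 2 * K₂ * RR * D₁ + K₁ * U' := by ring
      linarith
    linarith
  · -- the slope budget
    have h1 : K₂ * D₁ * (dist₀ + 2 * (hi / dd)) ≤ K₂ * D₁ * (1 + 2 / dd) * t := by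
      have : dist₀ + 2 * (hi / dd) ≤ (1 + 2 / dd) * t := by
        have h1 := div_le_div_of_nonneg_right hhit hdd.le
        have e1 : (1 + 2 / dd) * t = t + 2 * (t / dd) := by ring
        rw [e1]; linarith
      have := mul_le_mul_of_nonneg_left this (by positivity : 0 ≤ K₂ * D₁)
      linarith
    have h2 : K₂ * D₁ * (1 + 2 / dd) * t ≤ Q * t := by
      refine mul_le_mul_of_nonneg_right ?_ htpos.le
      rw [hQ]
      have : 0 ≤ (K₃ * D₁ ^ 2 + K₂ * D₂) * (1 + 1 / dd) + 2 * K₂ * RR * D₁ + K₁ * U' + K₂ * (1 + 2 / dd) / dd + K₁ + 1 := by positivity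
      linarith
    linarith
  · -- the rate window
    have hsplit : K₂ * (dist₀ + 2 * (hi / dd + D₁ * Wφ)) / dd = K₂ * (dist₀ + 2 * (hi / dd)) / dd + 2 * K₂ * D₁ * Wφ / dd := by
      field_simp; ring
    rw [hsplit]
    have h1 : K₂ * (dist₀ + 2 * (hi / dd)) / dd ≤ K₂ * (1 + 2 / dd) / dd * t := by
      have : dist₀ + 2 * (hi / dd) ≤ (1 + 2 / dd) * t := by
        have h1 := div_le_div_of_nonneg_right hhit hdd.le
        have e1 : (1 + 2 / dd) * t = t + 2 * (t / dd) := by ring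
        rw [e1]; linarith
      have h := mul_le_mul_of_nonneg_left this hK₂
      have h' := div_le_div_of_nonneg_right h hdd.le
      refine h'.trans (le_of_eq ?_)
      field_simp
    have h2 : K₂ * (1 + 2 / dd) / dd * t ≤ Q * t := by
      refine mul_le_mul_of_nonneg_right ?_ htpos.le
      rw [hQ]
      have : 0 ≤ (K₃ * D₁ ^ 2 + K₂ * D₂) * (1 + 1 / dd) + 2 * K₂ * RR * D₁ + K₁ * U' + K₂ * D₁ * (1 + 2 / dd) + K₁ + 1 := by positivity
      linarith
    have h3 : 2 * K₂ * D₁ * Wφ / dd ≤ 1 / 4 := by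
      rw [div_le_iff₀ hdd]; linarith
    linarith

section Sizes

variable {K : TrigPolyC4v} {A : ℝ} (hA : ∀ p : Momentum, ∀ j ≤ 2, ‖iteratedFDeriv ℝ j (frameShift K) p‖ ≤ A) (hA20 : A ≤ 1 / 20)
  (hd : klCurveD ≤ (bandBounds (show (-4 : ℝ) < -1.1 by norm_num) (show (-1.1 : ℝ) ≤ -0.1 by norm_num)
    (show (-0.1 : ℝ) < 0 by norm_num)).Dtmin - 2 * A)
  {μ r : ℝ} (hr : 0 < r) (hlo : (-1.1 : ℝ) < μ - r - A) (hhi : μ + r + A < -0.1)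
  {A₃ A₄ : ℝ} (hA₃ : ∀ p : Momentum, ‖iteratedFDeriv ℝ 3 (frameShift K) p‖ ≤ A₃)
  (hA₄ : ∀ p : Momentum, ‖iteratedFDeriv ℝ 4 (frameShift K) p‖ ≤ A₄)
  {K₁ K₂ K₃ : ℝ} (hK₁ : ∀ p : Momentum, ‖fderiv ℝ (frameLevel μ K) p‖ ≤ K₁) (hK₂ : ∀ p : Momentum, ‖iteratedFDeriv ℝ 2 (frameLevel μ K) p‖ ≤ K₂)
  (hK₃ : ∀ p : Momentum, ‖iteratedFDeriv ℝ 3 (frameLevel μ K) p‖ ≤ K₃)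
include hA hA20 hd hr hlo hhi hA₃ hA₄ hK₁ hK₂ hK₃

/-- **THE FOLD-BOX THRESHOLDS ARE JOINTLY FEASIBLE** (see the module docstring): positive `n`-free `Wφ, t` with the caustic budget `Δ := t + 2msD₁Wφ` admissible
(`K₁Δ < r`, `Δ ≤ 3/10`, `Δ ≤ u_min`) such that every `0 ≤ dist₀ ≤ t`, `0 < hi ≤ t` meets the modulus inequality at (`dist₀`, `hi`, `Wφ`), the slope budget with margin
`Wφ`, and the rate window — the hypotheses `hwin` (via `…C4aFoldBoxModulus.foldBox_hwin_of_le`), `hslope`, `hrate`, `hΔ…` of parts 4a/4b/5d at once. -/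
theorem exists_foldBox_thresholds {w : ℝ} (hw : 0 < w) :
    ∃ Wφ t : ℝ, 0 < Wφ ∧ 0 < t ∧ K₁ * (t + 2 * (msD A₃ A₄ 1 * Wφ)) < r ∧ t + 2 * (msD A₃ A₄ 1 * Wφ) ≤ 3 / 10 ∧
      t + 2 * (msD A₃ A₄ 1 * Wφ) ≤ (bandBounds (show (-4 : ℝ) < -1.1 by norm_num) (show (-1.1 : ℝ) ≤ -0.1 by norm_num) (show (-0.1 : ℝ) < 0 by norm_num)).umin ∧
      ∀ dist₀ hi : ℝ, 0 ≤ dist₀ → dist₀ ≤ t → 0 < hi → hi ≤ t →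
        K₃ * (dist₀ + hi / ((bandBounds (show (-4 : ℝ) < -1.1 by norm_num) (show (-1.1 : ℝ) ≤ -0.1 by norm_num) (show (-0.1 : ℝ) < 0 by norm_num)).Dtmin - 2 * A) +
                msD A₃ A₄ 1 * Wφ) * msD A₃ A₄ 1 ^ 2 +
            K₂ * (radialRowOneConst A ((bandBounds (show (-4 : ℝ) < -1.1 by norm_num) (show (-1.1 : ℝ) ≤ -0.1 by norm_num) (show (-0.1 : ℝ) < 0 by norm_num)).Dtmin -
                  2 * A) * hi + msD A₃ A₄ 2 * Wφ) * (msD A₃ A₄ 1 + msD A₃ A₄ 1) +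
            K₂ * (dist₀ + hi / ((bandBounds (show (-4 : ℝ) < -1.1 by norm_num) (show (-1.1 : ℝ) ≤ -0.1 by norm_num) (show (-0.1 : ℝ) < 0 by norm_num)).Dtmin - 2 * A) +
                msD A₃ A₄ 1 * Wφ) * msD A₃ A₄ 2 +
            K₁ * ((uRowTwoConst A A₃ ((bandBounds (show (-4 : ℝ) < -1.1 by norm_num) (show (-1.1 : ℝ) ≤ -0.1 by norm_num) (show (-0.1 : ℝ) < 0 by norm_num)).Dtmin -
                    2 * A) +
                  1 / ((bandBounds (show (-4 : ℝ) < -1.1 by norm_num) (show (-1.1 : ℝ) ≤ -0.1 by norm_num) (show (-0.1 : ℝ) < 0 by norm_num)).Dtmin - 2 * A) +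
                  2 * (radialRowOneConst A ((bandBounds (show (-4 : ℝ) < -1.1 by norm_num) (show (-1.1 : ℝ) ≤ -0.1 by norm_num)
                      (show (-0.1 : ℝ) < 0 by norm_num)).Dtmin - 2 * A) -
                    1 / ((bandBounds (show (-4 : ℝ) < -1.1 by norm_num) (show (-1.1 : ℝ) ≤ -0.1 by norm_num) (show (-0.1 : ℝ) < 0 by norm_num)).Dtmin - 2 * A))) *
                hi + msD A₃ A₄ 3 * Wφ) ≤
          w * (bandBounds (show (-4 : ℝ) < -1.1 by norm_num) (show (-1.1 : ℝ) ≤ -0.1 by norm_num) (show (-0.1 : ℝ) < 0 by norm_num)).umin ^ 2 ∧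
        K₂ * msD A₃ A₄ 1 * (dist₀ + 2 * (hi / ((bandBounds (show (-4 : ℝ) < -1.1 by norm_num) (show (-1.1 : ℝ) ≤ -0.1 by norm_num) (show (-0.1 : ℝ) < 0 by norm_num)).Dtmin - 2 * A))) ≤
          w * (bandBounds (show (-4 : ℝ) < -1.1 by norm_num) (show (-1.1 : ℝ) ≤ -0.1 by norm_num) (show (-0.1 : ℝ) < 0 by norm_num)).umin ^ 2 * Wφ ∧
        K₂ * (dist₀ + 2 * (hi / ((bandBounds (show (-4 : ℝ) < -1.1 by norm_num) (show (-1.1 : ℝ) ≤ -0.1 by norm_num) (show (-0.1 : ℝ) < 0 by norm_num)).Dtmin - 2 * A) +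
              msD A₃ A₄ 1 * Wφ)) /
            ((bandBounds (show (-4 : ℝ) < -1.1 by norm_num) (show (-1.1 : ℝ) ≤ -0.1 by norm_num) (show (-0.1 : ℝ) < 0 by norm_num)).Dtmin - 2 * A) ≤ 1 / 2 := by
  set B := bandBounds (show (-4 : ℝ) < -1.1 by norm_num) (show (-1.1 : ℝ) ≤ -0.1 by norm_num) (show (-0.1 : ℝ) < 0 by norm_num) with hBdef
  have hADt : 2 * A < B.Dtmin := by have := klCurveD_pos; linarith
  have hDt : 0 < B.Dtmin - 2 * A := by linarith
  have hA0 : 0 ≤ A := (norm_nonneg _).trans (hA 0 0 (by norm_num))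
  have hA₃0 : 0 ≤ A₃ := (norm_nonneg _).trans (hA₃ 0)
  have hK₁0 : 0 ≤ K₁ := (norm_nonneg _).trans (hK₁ 0)
  have hK₂0 : 0 ≤ K₂ := (norm_nonneg _).trans (hK₂ 0)
  have hK₃0 : 0 ≤ K₃ := (norm_nonneg _).trans (hK₃ 0)
  have h0r : |(0 : ℝ)| < r := by rw [abs_zero]; exact hr
  have hD₁ : 0 ≤ msD A₃ A₄ 1 := (msD_one_pos A₃ A₄).le
  have hD₂ : 0 ≤ msD A₃ A₄ 2 := (msD_two_pos A₃ A₄).le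
  have hD₃ : 0 ≤ msD A₃ A₄ 3 := (norm_nonneg _).trans (norm_iteratedDeriv_levelPoint_le hA hA20 hd hlo hhi hA₃ hA₄ h0r (by norm_num) (by norm_num) 0)
  have hRR : 0 ≤ radialRowOneConst A (B.Dtmin - 2 * A) := radialRowOneConst_nonneg hA0 hDt
  have hU : 0 ≤ uRowTwoConst A A₃ (B.Dtmin - 2 * A) + 1 / (B.Dtmin - 2 * A) + 2 * (radialRowOneConst A (B.Dtmin - 2 * A) - 1 / (B.Dtmin - 2 * A)) := by
    have := uRowTwoConst_nonneg hA0 hA₃0 hDt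
    have := radialRowOneConst_sub_inv_nonneg hA0 hDt
    positivity
  have hc₂ : 0 < w * B.umin ^ 2 := by have := B.umin_pos; positivity
  exact exists_foldBox_thresholds_abstract hK₁0 hK₂0 hK₃0 hD₁ hD₂ hD₃ hRR hU hDt hc₂ B.umin_pos hr

end Sizes

end Summit.HubbardSuperconductivity.HubbardSuperconductivity.Theorems.C4a

end
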